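import Mathlib
import Summits.QuantumAdvantage.QuantumAdvantage.Theses.MobiusLadder
import Summits.QuantumAdvantage.QuantumAdvantage.Theorems.MobiusLadderDigitPolyUniformityStubEnds
import Summits.QuantumAdvantage.QuantumAdvantage.Theorems.MobiusLadderDigitPolyUniformityWeakGlueRange
import HarnessLib

/-!
# Crux `DigitPolyUniformity` (stmt-QuantumAdvantage-1392), line `Sketch` — cycle 6 (seat c5):
# the weak target W of the `AC⁰[⊕]` rung follows from ×p-RIGIDITY of low-degree digital phases

Seat c4 (`Cruxes/DigitPolyUniformity/Lines/SketchLAR-c4-weak.md`) showed that the route's consumer of the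
crux, `LiouvilleNotAC0Xor : DigitPolyUniformity → L_λ ∉ AC0Mod 2`, needs only the WEAK TARGET

  W : `∃ c > 0, ∀ A, ∀ᶠ n, ∀ P ∈ 𝔽₂[x_0..x_{n−1}], deg P ≤ (log₂ n)^A → Σ_{N<2ⁿ} λ(N) χ_P(N) ≤ (1 − c) 2ⁿ`

(`liouvilleNotAC0Xor_of_inapprox_range`, `Theorems/…WeakGlueRange`, p135858), and analysed what a proof of
W must contain (§2 there): (i) PNT-strength input at both digit ends — `λ` is orthogonal to every "ends
function" `g(N mod 2^k, ⌊N/2^{n−m}⌋)`; this is IN THE TREE, unconditionally: line 0's `stub_ends`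
(`Theorems/…StubEnds`, p102479, depths `(k+m)^3 ≤ n`, Green's characters mod `2^t`), and, at unbounded top
depth, the cycle-5 Matomäki–Radziwiłł–Tao classes (`Theorems/…MRTClasses`); and (ii) a λ-FREE
×p-RIGIDITY statement: a polylog-degree digital phase `χ_P` that nearly solves the functional equations
`χ(pm) = −χ(m)` of `λ` for the boundedly many primes `p ≤ C` must correlate with an ends function (all the
near-solutions found — 2-adic shell characters, Benford chirps — are ends functions).

This file makes (ii) precise and PROVES THE REDUCTION `W ⇐ Rigidity` in the kernel
(`inapprox_range_of_rigidity`), so that Rigidity — a statement about 𝔽₂-polynomials of the binary digits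
and the maps `m ↦ pm`, with no Liouville function in it — can be filed as the λ-free crux of the rung R1.
The hypothesis, spelled out in the theorem (it is a CONJECTURE of this line, not a published fact; it is
never asserted):

  Rigidity : `∃ C η ρ, 0 < η ∧ 0 < ρ ∧ ∀ A, ∀ᶠ n, ∀ P, deg P ≤ (log₂ n)^A →
    (∀ p prime ≤ C, #{1 ≤ m < 2ⁿ/p : χ_P(pm) = χ_P(m)} ≤ η 2ⁿ) →
    ∃ k m, (k+m)^3 ≤ n ∧ ∃ g (1-bounded), ρ 2ⁿ ≤ |Σ_{N<2ⁿ} χ_P(N) g(N mod 2^k, ⌊N/2^{n−m}⌋)|`.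

Proof of the reduction (`c = min(η, ρ/4)`). If `Σ λ χ_P > (1 − c)2ⁿ` then, `λ` and `χ_P` being signs on
`[1, 2ⁿ)`, the disagreement set `E = {1 ≤ N < 2ⁿ : χ_P(N) ≠ λ(N)}` has `2|E| < c 2ⁿ` (`sum_eq_card`); since
`λ(pm) = −λ(m)` (`liouville_prime_mul`), `χ_P(pm) = χ_P(m)` forces `m ∈ E` or `pm ∈ E`, so every defect is
`≤ 2|E| < η 2ⁿ` (`defect_le`) and Rigidity yields an ends function `g` with `ρ 2ⁿ ≤ |Σ χ_P g|`; but
`|Σ χ_P g| ≤ |Σ λ g| + 1 + 2|E|` (`corr_transfer`) and `|Σ λ g| ≤ (ρ/4) 2ⁿ` by `stub_ends`, whence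
`ρ 2ⁿ < (ρ/2) 2ⁿ + 1`, false for `2ⁿ ≥ 2/ρ`.

No property of `λ` is used beyond `λ(N) ∈ {±1}` (`N ≥ 1`), `λ(0) = 0`, `λ(pm) = −λ(m)`, and `stub_ends`.
-/

noncomputable section

namespace Summit.QuantumAdvantage.DigitPolyUniformity.SketchLAR

open Filter Finset
open Summit.QuantumAdvantage.DigitPolyUniformity.Sketch (stub_ends)

namespace RigidityGlue

/-- `λ(p·m) = −λ(m)` for a prime `p` and `m ≠ 0` (`Ω` is completely additive). [folklore] -/
theorem liouville_prime_mul {p m : ℕ} (hp : p.Prime) (hm : m ≠ 0) :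
    ArithmeticFunction.liouville (p * m) = -ArithmeticFunction.liouville m := by
  rw [ArithmeticFunction.liouville_apply (mul_ne_zero hp.ne_zero hm),
    ArithmeticFunction.liouville_apply hm,
    ArithmeticFunction.cardFactors_mul hp.ne_zero hm, ArithmeticFunction.cardFactors_apply_prime hp,
    pow_add, pow_one]
  ring

/-- `λ(N) = ±1` as a real number, for `N ≠ 0`. [folklore] -/
theorem liouville_real_eq_or {N : ℕ} (hN : N ≠ 0) :
    (ArithmeticFunction.liouville N : ℝ) = 1 ∨ (ArithmeticFunction.liouville N : ℝ) = -1 := by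
  rw [ArithmeticFunction.liouville_apply hN]
  rcases neg_one_pow_eq_or ℤ (ArithmeticFunction.cardFactors N) with h | h
  · left; rw [h]; simp
  · right; rw [h]; simp

/-- **Agreement count.** For signs `lam, χ` on `[1, X)` with `lam 0 = 0`:
`Σ_{N<X} lam(N) χ(N) = (X − 1) − 2·|{1 ≤ N < X : χ N ≠ lam N}|` (`X ≥ 1`). [folklore] -/
theorem sum_eq_card {X : ℕ} (hX : 1 ≤ X) {lam χ : ℕ → ℝ} (hlam0 : lam 0 = 0)
    (hlam : ∀ N ∈ Ico 1 X, lam N = 1 ∨ lam N = -1) (hχ : ∀ N, χ N = 1 ∨ χ N = -1) :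
    ∑ N ∈ range X, lam N * χ N =
      ((X : ℝ) - 1) - 2 * (((Ico 1 X).filter fun N => χ N ≠ lam N).card : ℝ) := by
  have hsplit : ∑ N ∈ range X, lam N * χ N = ∑ N ∈ Ico 1 X, lam N * χ N := by
    rw [Finset.range_eq_Ico, Finset.sum_eq_sum_Ico_succ_bot (by omega), hlam0, zero_mul, zero_add]
  rw [hsplit]
  have hterm : ∀ N ∈ Ico 1 X, lam N * χ N = 1 - 2 * (if χ N ≠ lam N then (1 : ℝ) else 0) := by
    intro N hN
    rcases hlam N hN with h | h <;> rcases hχ N with h' | h' <;> simp [h, h'] <;> norm_num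
  rw [Finset.sum_congr rfl hterm, Finset.sum_sub_distrib, Finset.sum_const, ← Finset.mul_sum,
    Finset.sum_boole, Nat.card_Ico]
  simp only [nsmul_eq_mul, mul_one]
  push_cast [Nat.cast_sub hX]
  ring

/-- **Defect bound.** If every `m ∈ [1, M)` with `m ∉ E` and `p·m ∉ E` has `χ(pm) ≠ χ(m)`, and `m ↦ pm`
is injective (`p ≠ 0`), then `|{1 ≤ m < M : χ(pm) = χ(m)}| ≤ 2|E|`. [folklore] -/
theorem defect_le {p M : ℕ} (hp : p ≠ 0) (χ : ℕ → ℝ) (E : Finset ℕ)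
    (h : ∀ m ∈ Ico 1 M, m ∉ E → p * m ∉ E → χ (p * m) ≠ χ m) :
    ((Ico 1 M).filter fun m => χ (p * m) = χ m).card ≤ 2 * E.card := by
  have hsub : ((Ico 1 M).filter fun m => χ (p * m) = χ m) ⊆
      E ∪ ((Ico 1 M).filter fun m => p * m ∈ E) := by
    intro m hm
    rw [Finset.mem_filter] at hm
    rw [Finset.mem_union, Finset.mem_filter]
    by_contra hcon
    simp only [not_or, not_and] at hcon
    exact h m hm.1 hcon.1 (fun hpm => hcon.2 hm.1 hpm) hm.2
  have hinj : ((Ico 1 M).filter fun m => p * m ∈ E).card ≤ E.card := by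
    refine Finset.card_le_card_of_injOn (fun m => p * m) (fun m hm => ?_) ?_
    · exact (Finset.mem_filter.1 (Finset.mem_coe.1 hm)).2
    · intro a _ b _ hab
      exact Nat.eq_of_mul_eq_mul_left (Nat.pos_of_ne_zero hp) hab
  calc ((Ico 1 M).filter fun m => χ (p * m) = χ m).card
      ≤ (E ∪ ((Ico 1 M).filter fun m => p * m ∈ E)).card := Finset.card_le_card hsub
    _ ≤ E.card + ((Ico 1 M).filter fun m => p * m ∈ E).card := Finset.card_union_le _ _
    _ ≤ 2 * E.card := by omega

/-- **Correlation transfer.** For signs `lam, χ` on `[1, X)` with `lam 0 = 0`, `|χ 0| ≤ 1`, and a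
`1`-bounded weight `G`: `|Σ_{N<X} χ G| ≤ |Σ_{N<X} lam G| + 1 + 2|{1 ≤ N < X : χ N ≠ lam N}|`. [folklore] -/
theorem corr_transfer {X : ℕ} (hX : 1 ≤ X) {lam χ G : ℕ → ℝ} (hlam0 : lam 0 = 0)
    (hlam : ∀ N ∈ Ico 1 X, lam N = 1 ∨ lam N = -1) (hχ : ∀ N, χ N = 1 ∨ χ N = -1)
    (hG : ∀ N, |G N| ≤ 1) :
    |∑ N ∈ range X, χ N * G N| ≤ |∑ N ∈ range X, lam N * G N| + 1 +
      2 * (((Ico 1 X).filter fun N => χ N ≠ lam N).card : ℝ) := by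
  have hdiff : ∑ N ∈ range X, χ N * G N =
      ∑ N ∈ range X, lam N * G N + ∑ N ∈ range X, (χ N - lam N) * G N := by
    rw [← Finset.sum_add_distrib]; refine Finset.sum_congr rfl fun N _ => by ring
  -- the error sum
  have hsplit : ∑ N ∈ range X, (χ N - lam N) * G N =
      (χ 0 - lam 0) * G 0 + ∑ N ∈ Ico 1 X, (χ N - lam N) * G N := by
    rw [Finset.range_eq_Ico, Finset.sum_eq_sum_Ico_succ_bot (by omega)]
  have herr0 : |(χ 0 - lam 0) * G 0| ≤ 1 := by
    rw [hlam0, sub_zero, abs_mul]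
    have h1 : |χ 0| ≤ 1 := by rcases hχ 0 with h | h <;> simp [h]
    nlinarith [hG 0, abs_nonneg (χ 0), abs_nonneg (G 0)]
  have herr1 : |∑ N ∈ Ico 1 X, (χ N - lam N) * G N| ≤
      2 * (((Ico 1 X).filter fun N => χ N ≠ lam N).card : ℝ) := by
    refine (Finset.abs_sum_le_sum_abs _ _).trans ?_
    have hterm : ∀ N ∈ Ico 1 X, |(χ N - lam N) * G N| ≤ 2 * (if χ N ≠ lam N then (1 : ℝ) else 0) := by
      intro N hN
      rw [abs_mul]
      have hd : |χ N - lam N| ≤ 2 * (if χ N ≠ lam N then (1 : ℝ) else 0) := by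
        by_cases hne : χ N ≠ lam N
        · rw [if_pos hne, mul_one]
          have hχ1 : |χ N| ≤ 1 := by rcases hχ N with h | h <;> simp [h]
          have hl1 : |lam N| ≤ 1 := by rcases hlam N hN with h | h <;> simp [h]
          calc |χ N - lam N| ≤ |χ N| + |lam N| := abs_sub _ _
            _ ≤ 2 := by linarith
        · rw [if_neg hne]
          push Not at hne
          simp [hne]
      calc |χ N - lam N| * |G N| ≤ |χ N - lam N| * 1 :=
            mul_le_mul_of_nonneg_left (hG N) (abs_nonneg _)
        _ ≤ 2 * (if χ N ≠ lam N then (1 : ℝ) else 0) := by rw [mul_one]; exact hd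
    refine (Finset.sum_le_sum hterm).trans ?_
    rw [← Finset.mul_sum, Finset.sum_boole]
  have herr : |∑ N ∈ range X, (χ N - lam N) * G N| ≤
      1 + 2 * (((Ico 1 X).filter fun N => χ N ≠ lam N).card : ℝ) := by
    rw [hsplit]
    exact (abs_add_le _ _).trans (add_le_add herr0 herr1)
  rw [hdiff]
  calc |∑ N ∈ range X, lam N * G N + ∑ N ∈ range X, (χ N - lam N) * G N|
      ≤ |∑ N ∈ range X, lam N * G N| + |∑ N ∈ range X, (χ N - lam N) * G N| := abs_add_le _ _
    _ ≤ |∑ N ∈ range X, lam N * G N| + (1 + 2 * (((Ico 1 X).filter fun N => χ N ≠ lam N).card : ℝ)) :=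
        add_le_add le_rfl herr
    _ = _ := by ring

end RigidityGlue

open RigidityGlue in
/-- **The weak target W from ×p-rigidity.** If polylog-degree digital phases that nearly solve the
functional equations `χ(pm) = −χ(m)` for all primes `p ≤ C` must correlate with an ends function of depths
`(k+m)^3 ≤ n` (the hypothesis `hR`, a λ-FREE statement — the conjectural "×p-rigidity" of seat c4's analysis,
made precise; it is NOT a published fact and is never asserted in the tree), then for some `c > 0`, for
every `A`, eventually in `n`, NO `P ∈ 𝔽₂[x_0..x_{n−1}]` of total degree `≤ (log₂ n)^A` has
`Σ_{N<2ⁿ} λ(N)(−1)^{P(bits N)} > (1 − c) 2ⁿ` — the hypothesis of the landed weak glue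
`liouvilleNotAC0Xor_of_inapprox_range` (p135858), which then gives `L_λ ∉ AC0Mod 2`. The λ-input is
exactly line 0's `stub_ends` (`λ` ⊥ ends functions, unconditional) and `λ(pm) = −λ(m)`.
[cite: Green2012, Theorem 3 and §1 (remark on the Liouville function)] -/
theorem inapprox_range_of_rigidity
    (hR : ∃ C : ℕ, ∃ η ρ : ℝ, 0 < η ∧ 0 < ρ ∧ ∀ A : ℕ, ∀ᶠ n : ℕ in atTop,
      ∀ P : MvPolynomial (Fin n) (ZMod 2), P.totalDegree ≤ Nat.log 2 n ^ A →
        (∀ p : ℕ, p.Prime → p ≤ C →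
          ((((Ico 1 (2 ^ n / p)).filter fun m =>
              (if MvPolynomial.eval (fun i : Fin n => if Nat.testBit (p * m) i then (1 : ZMod 2) else 0) P = 1
                then (-1 : ℝ) else 1) =
              (if MvPolynomial.eval (fun i : Fin n => if Nat.testBit m i then (1 : ZMod 2) else 0) P = 1
                then (-1 : ℝ) else 1)).card : ℕ) : ℝ) ≤ η * 2 ^ n) →
        ∃ k m : ℕ, (k + m) ^ 3 ≤ n ∧ ∃ g : ℕ → ℕ → ℝ, (∀ a b, |g a b| ≤ 1) ∧
          ρ * 2 ^ n ≤ |∑ N ∈ range (2 ^ n),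
            (if MvPolynomial.eval (fun i : Fin n => if Nat.testBit N i then (1 : ZMod 2) else 0) P = 1
              then (-1 : ℝ) else 1) * g (N % 2 ^ k) (N / 2 ^ (n - m))|) :
    ∃ c : ℝ, 0 < c ∧ ∀ A : ℕ, ∀ᶠ n : ℕ in atTop, ∀ P : MvPolynomial (Fin n) (ZMod 2),
        P.totalDegree ≤ Nat.log 2 n ^ A →
          ∑ N ∈ Finset.range (2 ^ n), ((ArithmeticFunction.liouville N : ℤ) : ℝ) *
              (if MvPolynomial.eval (fun i : Fin n => if Nat.testBit N i then (1 : ZMod 2) else 0) P = 1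
                then (-1 : ℝ) else 1) ≤ (1 - c) * (2 : ℝ) ^ n := by
  obtain ⟨C, η, ρ, hη, hρ, hR⟩ := hR
  refine ⟨min η (ρ / 4), lt_min hη (by positivity), fun A => ?_⟩
  have hends := stub_ends (ρ / 4) (by positivity)
  have hbig : ∀ᶠ n : ℕ in atTop, 2 / ρ ≤ (2 : ℝ) ^ n := by
    refine (Filter.eventually_ge_atTop ⌈2 / ρ⌉₊).mono fun n hn => ?_
    have h1 : (2 / ρ : ℝ) ≤ n := (Nat.le_ceil _).trans (by exact_mod_cast hn)
    have h2 : (n : ℝ) ≤ (2 : ℝ) ^ n := by exact_mod_cast Nat.lt_two_pow_self.le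
    linarith
  filter_upwards [hR A, hends, hbig] with n hRn hEn hbn P hP
  -- notation: the phase and the Liouville sign
  set φ : ℕ → ℝ := fun N =>
    (if MvPolynomial.eval (fun i : Fin n => if Nat.testBit N i then (1 : ZMod 2) else 0) P = 1
      then (-1 : ℝ) else 1) with hφdef
  set lam : ℕ → ℝ := fun N => ((ArithmeticFunction.liouville N : ℤ) : ℝ) with hlamdef
  have hφ : ∀ N, φ N = 1 ∨ φ N = -1 := fun N => by
    simp only [hφdef]; split_ifs <;> simp
  have hlam0 : lam 0 = 0 := by simp [hlamdef]
  have hlam : ∀ N ∈ Ico 1 (2 ^ n), lam N = 1 ∨ lam N = -1 := fun N hN =>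
    liouville_real_eq_or (by have := (Finset.mem_Ico.1 hN).1; omega)
  have hX : 1 ≤ 2 ^ n := Nat.one_le_two_pow
  -- the statement is about `Σ lam · φ`
  show ∑ N ∈ range (2 ^ n), lam N * φ N ≤ (1 - min η (ρ / 4)) * 2 ^ n
  by_contra hcon
  rw [not_le] at hcon
  -- the disagreement set `E` and its size
  set E : Finset ℕ := (Ico 1 (2 ^ n)).filter fun N => φ N ≠ lam N with hEdef
  have hcount := sum_eq_card hX hlam0 hlam hφ
  rw [hcount] at hcon
  have hc1 : min η (ρ / 4) ≤ η := min_le_left _ _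
  have hc2 : min η (ρ / 4) ≤ ρ / 4 := min_le_right _ _
  have h2n : (0 : ℝ) < 2 ^ n := by positivity
  have hE : 2 * (E.card : ℝ) < min η (ρ / 4) * 2 ^ n := by
    rw [hEdef]; push_cast at hcon; linarith
  -- the defects are small
  have hdef : ∀ p : ℕ, p.Prime → p ≤ C →
      ((((Ico 1 (2 ^ n / p)).filter fun m => φ (p * m) = φ m).card : ℕ) : ℝ) ≤ η * 2 ^ n := by
    intro p hp _
    have hle := defect_le (M := 2 ^ n / p) hp.ne_zero φ E (fun m hm hmE hpmE => ?_)
    · have : (((Ico 1 (2 ^ n / p)).filter fun m => φ (p * m) = φ m).card : ℝ) ≤ 2 * E.card := by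
        exact_mod_cast hle
      nlinarith
    · -- off `E`, `φ` agrees with `lam`, and `lam (p m) = - lam m`
      have hm1 : 1 ≤ m := (Finset.mem_Ico.1 hm).1
      have hmM : m < 2 ^ n / p := (Finset.mem_Ico.1 hm).2
      have hpm : p * m < 2 ^ n := by
        have := Nat.div_mul_le_self (2 ^ n) p
        have h' : p * m < p * (2 ^ n / p) := Nat.mul_lt_mul_of_pos_left hmM hp.pos
        rw [mul_comm p (2 ^ n / p)] at h'
        omega
      have hmle : m ≤ p * m := Nat.le_mul_of_pos_left m hp.pos
      have hmI : m ∈ Ico 1 (2 ^ n) := Finset.mem_Ico.2 ⟨hm1, by omega⟩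
      have hpmI : p * m ∈ Ico 1 (2 ^ n) := Finset.mem_Ico.2 ⟨by omega, hpm⟩
      have hφm : φ m = lam m := by
        by_contra hne; exact hmE (Finset.mem_filter.2 ⟨hmI, hne⟩)
      have hφpm : φ (p * m) = lam (p * m) := by
        by_contra hne; exact hpmE (Finset.mem_filter.2 ⟨hpmI, hne⟩)
      have hlampm : lam (p * m) = -lam m := by
        simp only [hlamdef]
        rw [liouville_prime_mul hp (by omega)]
        push_cast; ring
      rw [hφpm, hφm, hlampm]
      rcases hlam m hmI with h | h <;> rw [h] <;> norm_num
  -- rigidity gives an ends correlator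
  obtain ⟨k, m, hkm, g, hg, hcorr⟩ := hRn P hP hdef
  -- but `λ` is orthogonal to ends functions (`stub_ends`) and `φ ≈ λ`
  have hends' := hEn k m hkm g hg
  have htrans := corr_transfer hX hlam0 hlam hφ (G := fun N => g (N % 2 ^ k) (N / 2 ^ (n - m)))
    (fun N => hg _ _)
  have hρ2 : ρ * 2 ^ n < ρ / 2 * 2 ^ n + 1 := by
    calc ρ * 2 ^ n ≤ |∑ N ∈ range (2 ^ n), φ N * g (N % 2 ^ k) (N / 2 ^ (n - m))| := hcorr
      _ ≤ |∑ N ∈ range (2 ^ n), lam N * g (N % 2 ^ k) (N / 2 ^ (n - m))| + 1 + 2 * (E.card : ℝ) :=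
          htrans
      _ < ρ / 4 * 2 ^ n + 1 + ρ / 4 * 2 ^ n := by nlinarith [hends']
      _ = ρ / 2 * 2 ^ n + 1 := by ring
  -- contradiction with `2^n ≥ 2/ρ`
  have : ρ / 2 * 2 ^ n < 1 := by linarith
  rw [div_le_iff₀ hρ] at hbn
  nlinarith

/-- **The `AC⁰[⊕]` rung from ×p-rigidity.** Under the same λ-free rigidity hypothesis, the Liouville
language `L_λ = {bin(N) : λ(N) = −1}` is not in `AC0Mod 2` — composition of `inapprox_range_of_rigidity`
with the landed weak glue `liouvilleNotAC0Xor_of_inapprox_range` (Razborov–Smolensky at the top `t+1`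
lengths, p135858). So the rung R1 of the route rests on: Rigidity (open, λ-free) + `stub_ends` (proved) +
Razborov–Smolensky (proved). [cite: Razborov1987] [cite: Smolensky1987] -/
theorem liouvilleNotAC0Xor_of_rigidity
    (hR : ∃ C : ℕ, ∃ η ρ : ℝ, 0 < η ∧ 0 < ρ ∧ ∀ A : ℕ, ∀ᶠ n : ℕ in atTop,
      ∀ P : MvPolynomial (Fin n) (ZMod 2), P.totalDegree ≤ Nat.log 2 n ^ A →
        (∀ p : ℕ, p.Prime → p ≤ C →
          ((((Ico 1 (2 ^ n / p)).filter fun m =>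
              (if MvPolynomial.eval (fun i : Fin n => if Nat.testBit (p * m) i then (1 : ZMod 2) else 0) P = 1
                then (-1 : ℝ) else 1) =
              (if MvPolynomial.eval (fun i : Fin n => if Nat.testBit m i then (1 : ZMod 2) else 0) P = 1
                then (-1 : ℝ) else 1)).card : ℕ) : ℝ) ≤ η * 2 ^ n) →
        ∃ k m : ℕ, (k + m) ^ 3 ≤ n ∧ ∃ g : ℕ → ℕ → ℝ, (∀ a b, |g a b| ≤ 1) ∧
          ρ * 2 ^ n ≤ |∑ N ∈ range (2 ^ n),
            (if MvPolynomial.eval (fun i : Fin n => if Nat.testBit N i then (1 : ZMod 2) else 0) P = 1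
              then (-1 : ℝ) else 1) * g (N % 2 ^ k) (N / 2 ^ (n - m))|) :
    Computability.encodingNatBool.toLanguage {N : ℕ | ArithmeticFunction.liouville N = -1} ∉
      Literature.Computability.Complexity.AC0Mod 2 :=
  liouvilleNotAC0Xor_of_inapprox_range (inapprox_range_of_rigidity hR)

end Summit.QuantumAdvantage.DigitPolyUniformity.SketchLAR

end
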